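import Summits.Schanuel.Schanuel.Theorems.ZilberEacMovingLineFast
import HarnessLib

/-!
# The mixed fast/slow regime over real hyperplanes: the substitution (definitions)

Zilber's Exponential-Algebraic Closedness, case ladder (host summit Schanuel, cell `pub-schanuel`,
seat 2, gen 8).  Bookkeeping for THEOREM R⁺⁺ (`ZilberEacRealHyperplaneFast`): for the systems
`e^{xⱼ} = Aⱼ(x) + e^{ℓ(x)} Fⱼ(e^{ℓ(x)})` (`j ≤ s`), `ℓ(x) = Σᵢ rᵢ xᵢ + c` (`rᵢ ∈ ℝ`, `r₀ ≠ 0`), whose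
solutions are the exponential points of the `(s+2)`-folds
`{x_{s+2} = ℓ(x), yⱼ = Aⱼ(x) + y_{s+2} Fⱼ(y_{s+2})}` of the first open range `dim π(V) = n - 1`
(members of `EC(3,2)` for `s + 1 = 2`), the distinguished fibre `j = 0` is put into the FAST regime
by the substitution `z₀ = e · ℓ(x)` (`e = 1 + deg F₀`), `zⱼ = xⱼ` (`j ≥ 1`):

* `fastBack r c e z` — the inverse substitution `x₀ = (z₀/e - Σ_{i≥1} rᵢ zᵢ - c)/r₀`, `xⱼ = zⱼ`;
* `fastSubst r c e` — the same as a substitution of polynomials, with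
  `eval z (aeval (fastSubst …) p) = eval (fastBack … z) p` (`eval_aeval_fastSubst`) and
  `ℓ(fastBack z) = z₀/e` (`ell_fastBack`);
* `fastData r c A F` — the transformed additive polynomials `Â₀ = -A₀∘φ/lc(F₀)`, `Âⱼ = Aⱼ∘φ`.

HONEST FRAMING: bookkeeping for an existence theorem about explicit members of an OPEN cell
(`ECCell 3 2`); nothing here bears on Schanuel's conjecture; EAC ⇏ SC.
-/

noncomputable section

open Complex MvPolynomial Filter Topology

set_option linter.dupNamespace false

namespace Summit.Schanuel.Schanuel.Theorems

section FastSubst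

variable {s : ℕ}

/-- The real hyperplane functional `ℓ(x) = Σᵢ rᵢ xᵢ + c`. [folklore] -/
def ell (r : Fin (s + 1) → ℝ) (c : ℂ) (x : Fin (s + 1) → ℂ) : ℂ := ∑ i, (r i : ℂ) * x i + c

/-- **The inverse substitution** `x = ψ(z)`: `x₀ = (z₀/e - Σ_{i≥1} rᵢ zᵢ - c)/r₀`, `xⱼ = zⱼ` (`j ≥ 1`).
[folklore] -/
def fastBack (r : Fin (s + 1) → ℝ) (c : ℂ) (e : ℕ) (z : Fin (s + 1) → ℂ) : Fin (s + 1) → ℂ :=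
  Fin.cons ((z 0 / (e : ℂ) - ∑ i : Fin s, (r i.succ : ℂ) * z i.succ - c) / (r 0 : ℂ)) (fun i => z i.succ)

/-- Coordinate `0` of `ψ(z)`. [folklore] -/
@[simp] theorem fastBack_zero (r : Fin (s + 1) → ℝ) (c : ℂ) (e : ℕ) (z : Fin (s + 1) → ℂ) :
    fastBack r c e z 0 = (z 0 / (e : ℂ) - ∑ i : Fin s, (r i.succ : ℂ) * z i.succ - c) / (r 0 : ℂ) := by
  simp [fastBack]

/-- Coordinates `≥ 1` of `ψ(z)`. [folklore] -/
@[simp] theorem fastBack_succ (r : Fin (s + 1) → ℝ) (c : ℂ) (e : ℕ) (z : Fin (s + 1) → ℂ) (i : Fin s) :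
    fastBack r c e z i.succ = z i.succ := by
  simp [fastBack]

/-- **`ℓ(ψ(z)) = z₀/e`** (`r₀ ≠ 0`). [folklore] -/
theorem ell_fastBack {r : Fin (s + 1) → ℝ} (hr : r 0 ≠ 0) (c : ℂ) (e : ℕ) (z : Fin (s + 1) → ℂ) :
    ell r c (fastBack r c e z) = z 0 / (e : ℂ) := by
  have hr' : (r 0 : ℂ) ≠ 0 := by exact_mod_cast hr
  rw [ell, Fin.sum_univ_succ, fastBack_zero]
  simp only [fastBack_succ]
  field_simp
  ring

/-- **The substitution of polynomials** `φ`: `X₀ ↦ (X₀/e - Σ_{i≥1} rᵢ Xᵢ - c)/r₀`, `Xⱼ ↦ Xⱼ`.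
[folklore] -/
def fastSubst (r : Fin (s + 1) → ℝ) (c : ℂ) (e : ℕ) : Fin (s + 1) → MvPolynomial (Fin (s + 1)) ℂ :=
  Fin.cons (C ((r 0 : ℂ)⁻¹) * (C ((e : ℂ)⁻¹) * X 0 - ∑ i : Fin s, C (r i.succ : ℂ) * X i.succ - C c))
    (fun i => X i.succ)

/-- `eval z (φ k) = ψ(z) k`. [folklore] -/
theorem eval_fastSubst (r : Fin (s + 1) → ℝ) (c : ℂ) (e : ℕ) (z : Fin (s + 1) → ℂ) (k : Fin (s + 1)) :
    eval z (fastSubst r c e k) = fastBack r c e z k := by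
  refine Fin.cases ?_ (fun i => ?_) k
  · simp only [fastSubst, Fin.cons_zero, fastBack_zero, map_mul, eval_C, map_sub, eval_X, map_sum]
    rw [div_eq_mul_inv, div_eq_mul_inv]
    ring
  · simp [fastSubst, fastBack]

/-- **`(p ∘ φ)(z) = p(ψ(z))`**, `aeval` form. [folklore] -/
theorem aeval_aeval_fastSubst (r : Fin (s + 1) → ℝ) (c : ℂ) (e : ℕ) (z : Fin (s + 1) → ℂ)
    (p : MvPolynomial (Fin (s + 1)) ℂ) :
    aeval z (aeval (fastSubst r c e) p) = aeval (fastBack r c e z) p := by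
  have hfun : (fun i => aeval z (fastSubst r c e i)) = fastBack r c e z := by
    funext k
    exact eval_fastSubst r c e z k
  rw [← AlgHom.comp_apply, comp_aeval, hfun]

/-- **`(p ∘ φ)(z) = p(ψ(z))`**. [folklore] -/
theorem eval_aeval_fastSubst (r : Fin (s + 1) → ℝ) (c : ℂ) (e : ℕ) (z : Fin (s + 1) → ℂ)
    (p : MvPolynomial (Fin (s + 1)) ℂ) :
    eval z (aeval (fastSubst r c e) p) = eval (fastBack r c e z) p :=
  aeval_aeval_fastSubst r c e z p

/-- **The transformed additive polynomials** `Â`: `Â₀ = -(A₀ ∘ φ)/lc(F₀)`, `Âⱼ = Aⱼ ∘ φ` (`j ≥ 1`),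
with `e = 1 + deg F₀`. [folklore] -/
def fastData (r : Fin (s + 1) → ℝ) (c : ℂ) (A : Fin (s + 1) → MvPolynomial (Fin (s + 1)) ℂ)
    (F : Fin (s + 1) → Polynomial ℂ) : Fin (s + 1) → MvPolynomial (Fin (s + 1)) ℂ :=
  Fin.cons (C (-((F 0).leadingCoeff)⁻¹) * aeval (fastSubst r c ((F 0).natDegree + 1)) (A 0))
    (fun i => aeval (fastSubst r c ((F 0).natDegree + 1)) (A i.succ))

/-- `Â₀`. [folklore] -/
@[simp] theorem fastData_zero (r : Fin (s + 1) → ℝ) (c : ℂ) (A : Fin (s + 1) → MvPolynomial (Fin (s + 1)) ℂ)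
    (F : Fin (s + 1) → Polynomial ℂ) :
    fastData r c A F 0 = C (-((F 0).leadingCoeff)⁻¹) * aeval (fastSubst r c ((F 0).natDegree + 1)) (A 0) := by
  simp [fastData]

/-- `Âⱼ`, `j ≥ 1`. [folklore] -/
@[simp] theorem fastData_succ (r : Fin (s + 1) → ℝ) (c : ℂ) (A : Fin (s + 1) → MvPolynomial (Fin (s + 1)) ℂ)
    (F : Fin (s + 1) → Polynomial ℂ) (i : Fin s) :
    fastData r c A F i.succ = aeval (fastSubst r c ((F 0).natDegree + 1)) (A i.succ) := by
  simp [fastData]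

/-- Evaluation of `Â₀` at `z`: `-A₀(ψ(z))/lc(F₀)`. [folklore] -/
theorem eval_fastData_zero (r : Fin (s + 1) → ℝ) (c : ℂ) (A : Fin (s + 1) → MvPolynomial (Fin (s + 1)) ℂ)
    (F : Fin (s + 1) → Polynomial ℂ) (z : Fin (s + 1) → ℂ) :
    eval z (fastData r c A F 0) =
      -((F 0).leadingCoeff)⁻¹ * eval (fastBack r c ((F 0).natDegree + 1) z) (A 0) := by
  rw [fastData_zero, map_mul, eval_C, eval_aeval_fastSubst]

/-- Evaluation of `Âⱼ` (`j ≥ 1`) at `z`: `Aⱼ(ψ(z))`. [folklore] -/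
theorem eval_fastData_succ (r : Fin (s + 1) → ℝ) (c : ℂ) (A : Fin (s + 1) → MvPolynomial (Fin (s + 1)) ℂ)
    (F : Fin (s + 1) → Polynomial ℂ) (z : Fin (s + 1) → ℂ) (i : Fin s) :
    eval z (fastData r c A F i.succ) = eval (fastBack r c ((F 0).natDegree + 1) z) (A i.succ) := by
  rw [fastData_succ, eval_aeval_fastSubst]

/-- **The algebra of the fast coordinate.**  If `c₀ e^{z₀} = -A₀(x) + (e^{x₀} - u F̃₀(u))` with
`u = e^{z₀/e}`, `e = 1 + deg F₀`, `c₀ = lc F₀`, `F̃₀ = eraseLead F₀`, then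
`e^{x₀} = A₀(x) + u F₀(u)`. [folklore] -/
theorem exp_eq_of_fast_identity (F₀ : Polynomial ℂ) {z₀ x₀ a₀ : ℂ}
    (h : F₀.leadingCoeff * exp z₀ = -a₀ + (exp x₀ -
      exp (z₀ / ((F₀.natDegree + 1 : ℕ) : ℂ)) * F₀.eraseLead.eval (exp (z₀ / ((F₀.natDegree + 1 : ℕ) : ℂ))))) :
    exp x₀ = a₀ + exp (z₀ / ((F₀.natDegree + 1 : ℕ) : ℂ)) * F₀.eval (exp (z₀ / ((F₀.natDegree + 1 : ℕ) : ℂ))) := by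
  set e : ℕ := F₀.natDegree + 1 with he
  set u : ℂ := exp (z₀ / (e : ℂ)) with hu
  have hue : u ^ e = exp z₀ := by
    rw [hu, ← Complex.exp_nat_mul, mul_div_cancel₀ _ (by exact_mod_cast (show e ≠ 0 by positivity))]
  have hsplit := mul_eval_eq_leadingCoeff_mul_pow_add F₀ u
  rw [← he, hue] at hsplit
  rw [hsplit]
  linear_combination -h

end FastSubst

end Summit.Schanuel.Schanuel.Theorems

end
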